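import Literature.AnabelianGeometry.AbsoluteAnabelian.AbsTopIII.Thm19KummerContainerDirected
import Literature.AnabelianGeometry.AbsoluteAnabelian.AbsTopIII.Thm19BaseChangeCoefficients
import Literature.AnabelianGeometry.AbsoluteAnabelian.AbsTopIII.KummerFaithful
import HarnessLib

/-!
# [AbsTopIII] Thm. 1.9 (d), "`K_{Z_NF}^× ↪ lim_{→V} H¹(Π_V, μ_Ẑ(Π_U))`": the Kummer maps into the
# container are injective — from Prop. 1.6 (i) and the NATURALITY of the Kummer maps

Mochizuki, *Topics in Absolute Anabelian Geometry III*, §1, Theorem 1.9 (d), manuscript pp. 37–38 (lit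
key `paper:url-5493eb38cbb7`): "`k̄_NF^× ⊆ K_{Z_NF}^× ↪ lim_{→V} H¹(Π_V, μ_Ẑ(Π_U))` [...] the '`↪`'
arises from the Kummer map"; Prop. 1.6 (i) p. 34: "The Kummer map `κ_U` is injective"; Rmk. 1.5.4 (i)
p. 33: "sub-`p`-adic ⟹ Kummer-faithful".

Proof-only companion (cell abc-iut, sub-DAG `plan/L4/SUBDAG-AbsTopIII-Thm19.md` row Thm19.d.r8,
holder w5-d099 after w5-d213) of `Thm19KummerContainer.lean` (p414838; the named statement
`IntrinsicKummerModel.Thm19d_inj`).  The printed injectivity is the composite of three facts: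
(1) injectivity of `κ_{V_j}` at every level (Prop. 1.6 (i), for the Kummer-faithful = sub-`p`-adic
base fields `k′_j`, Rmk. 1.5.4 (i)) — abc-iut-L4-t1's NAMED FACTS `IntrinsicKummerModel.Prop_1_6_i`,
`Rmk_1_5_4_i`, consumed BY NAME; (2) injectivity of the identification of coefficients
`μ_Ẑ(Π_U) := M_Z` at every level (`pushToZ_injective`, PROVED in `Thm19BaseChangeCoefficients.lean`) and
exactness of the direct limit (`toContainer_eq_zero_iff'`, PROVED in `Thm19KummerContainerDirected.lean`);
(3) NATURALITY of the Kummer maps with respect to the transition morphisms `V_j → V_i` of the directed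
system — `κ_{V_j}(f|_{V_j}) = κ_{V_i}(f)|_{Π_{V_j}}` for the (injective) restriction of regular units.
Item (3) is NOT part of the interface `IntrinsicKummerModel` (its `kummerMap` is recorded
presentation by presentation, with no law relating different opens: GAP-LEDGER row G-w5d213-1 of the
cell), so it enters here as EXPLICIT HYPOTHESES in Lean-signature form — a unit-restriction map `ρ`
along each transition together with its injectivity and the naturality square — never as a new
definition.  Results:

* `IntrinsicKummerModel.kummerAddHom_injective_of_prop16i` — Prop. 1.6 (i) in additive form;
* `IntrinsicKummerModel.kummerLevel_injective` — injectivity of the level Kummer map with coefficients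
  `M_Z` (Prop. 1.6 (i) + Rmk. 1.5.4 (i) + `pushToZ_injective`);
* `IntrinsicKummerModel.kummerToContainer_injective_of_naturality` — **injectivity into the container**
  for ONE directed system, modulo the naturality hypotheses (3);
* `IntrinsicKummerModel.thm19d_inj_of_naturality` — the named statement `Thm19d_inj M` from
  `Prop_1_6_i`, `Rmk_1_5_4_i` and the naturality hypotheses for every directed system.

HONEST FRAMING: (3) is an interface law still to be supplied by the model (typed ≠ proved for the
node); nothing here bears on [IUTchIII] Cor. 3.12.
-/

noncomputable section

open CategoryTheory

namespace Literature.AnabelianGeometry.AbsoluteAnabelian.AbsTopIII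

universe u

namespace IntrinsicKummerModel

variable (M : IntrinsicKummerModel.{u})

/-- **Prop. 1.6 (i), additive form**: under `Prop_1_6_i M`, for a cofinite open `U ⊆ X` of a proper
scheme-like `X` of genus `≥ 2` over a Kummer-faithful field, the additive Kummer map
`Γ(U, 𝒪_U^×) → H¹(Π_U, M_X)` is injective. [cite: MochizukiAbsTopIII2015, Prop 1.6 (i) p.34] -/
theorem kummerAddHom_injective_of_prop16i (h16 : M.Prop_1_6_i) {U X : M.Curve}
    (h : M.IsCofiniteOpen U X) (hX : M.IsProper X) (hU : M.IsScheme U) (hXs : M.IsScheme X)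
    (hg : 2 ≤ M.genus X) (hk : IsKummerFaithful (M.base U)) :
    Function.Injective (M.kummerAddHom h hX) := by
  intro x y hxy
  have hinj := h16 U X h hX hU hXs hg hk
  change Multiplicative.toAdd (M.kummerMap h hX (Additive.toMul x)) =
    Multiplicative.toAdd (M.kummerMap h hX (Additive.toMul y)) at hxy
  exact Additive.toMul.injective (hinj (Multiplicative.toAdd.injective hxy))

variable {Z : M.Curve} {ι : Type u} [Preorder ι] (S : CurveModel.NFComplementSystem M.toCurveModel Z ι)

/-- **The level Kummer map with coefficients `M_Z` is injective**: `Γ(V_i, 𝒪^×) → H¹(Π_{V_i}, M_Z)`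
(`kummerLevel`), for a directed system of NF-complements over a (d)-input `Z` — Prop. 1.6 (i) at the
level `V_i ⊆ Z ×_{k_Z} k′_i` (genus `≥ 2`, base field sub-`p`-adic hence Kummer-faithful by
Rmk. 1.5.4 (i)) composed with the injective change of coefficients `pushToZ`.
[cite: MochizukiAbsTopIII2015, Thm 1.9 (d) p.38] -/
theorem kummerLevel_injective (hZ : M.IsThm19dInput Z) (h16 : M.Prop_1_6_i)
    (h154 : Rmk_1_5_4_i.{u}) (i : ι) : Function.Injective (M.kummerLevel S i) := by
  have hk : IsKummerFaithful (M.base (S.V i)) := h154 _ (S.isSubpadic i)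
  have hg : 2 ≤ M.genus (S.Zb i) := by rw [S.genus_eq i]; exact hZ.two_le_genus
  intro x y hxy
  rw [kummerLevel_apply, kummerLevel_apply] at hxy
  exact M.kummerAddHom_injective_of_prop16i h16 (S.isOpen i) (S.isProper i) (S.isScheme i).1
    (S.isScheme i).2 hg hk (M.pushToZ_injective S i hxy)

/-- **"`K_{Z_NF}^× ↪ lim_{→V} H¹(Π_V, μ_Ẑ(Π_U))`" for one directed system, modulo naturality**: if the
Kummer maps of the levels are NATURAL with respect to the transitions — for every `i ≤ j` an injective
restriction of regular units `ρ : Γ(V_i, 𝒪^×) → Γ(V_j, 𝒪^×)` with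
`κ_{V_i}(f)|_{Π_{V_j}} = κ_{V_j}(ρ f)` (coefficients `M_Z`) — then every Kummer map into the container
is injective.  Inputs BY NAME: `Prop_1_6_i`, `Rmk_1_5_4_i`.
[cite: MochizukiAbsTopIII2015, Thm 1.9 (d) p.38] -/
theorem kummerToContainer_injective_of_naturality [IsDirectedOrder ι] (hZ : M.IsThm19dInput Z)
    (h16 : M.Prop_1_6_i) (h154 : Rmk_1_5_4_i.{u})
    (ρ : ∀ ⦃i j : ι⦄, i ≤ j →
      (Additive (M.regularUnits (S.V i)) →+ Additive (M.regularUnits (S.V j))))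
    (hρ : ∀ ⦃i j : ι⦄ (h : i ≤ j), Function.Injective (ρ h))
    (hnat : ∀ ⦃i j : ι⦄ (h : i ≤ j) (f : Additive (M.regularUnits (S.V i))),
      S.transition i j h (M.kummerLevel S i f) = M.kummerLevel S j (ρ h f))
    (i : ι) : Function.Injective (M.kummerToContainer S i) := by
  refine (injective_iff_map_eq_zero _).2 fun f hf => ?_
  rw [kummerToContainer_apply] at hf
  obtain ⟨j, hij, hj⟩ := (S.toContainer_eq_zero_iff' _).1 hf
  rw [hnat hij f] at hj
  have h0 : ρ hij f = 0 :=
    (injective_iff_map_eq_zero _).1 (M.kummerLevel_injective S hZ h16 h154 j) _ hj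
  exact (injective_iff_map_eq_zero _).1 (hρ hij) f h0

/-- **Thm. 1.9 (d), injectivity (`Thm19d_inj`), from Prop. 1.6 (i), Rmk. 1.5.4 (i) and the naturality
of the Kummer maps**: if for EVERY directed system of NF-complements over a (d)-input the level Kummer
maps are natural with respect to injective unit restrictions along the transitions (the interface law
recorded as GAP-LEDGER G-w5d213-1, here an explicit hypothesis), then the named statement
`Thm19d_inj M` holds. [cite: MochizukiAbsTopIII2015, Thm 1.9 (d) p.37] -/
theorem thm19d_inj_of_naturality (h16 : M.Prop_1_6_i) (h154 : Rmk_1_5_4_i.{u})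
    (hnat : ∀ (Z : M.Curve), M.IsThm19dInput Z → ∀ (ι : Type u) [Preorder ι]
      (S : CurveModel.NFComplementSystem M.toCurveModel Z ι),
      ∃ ρ : ∀ ⦃i j : ι⦄, i ≤ j →
          (Additive (M.regularUnits (S.V i)) →+ Additive (M.regularUnits (S.V j))),
        (∀ ⦃i j : ι⦄ (h : i ≤ j), Function.Injective (ρ h)) ∧
          ∀ ⦃i j : ι⦄ (h : i ≤ j) (f : Additive (M.regularUnits (S.V i))),
            S.transition i j h (M.kummerLevel S i f) = M.kummerLevel S j (ρ h f)) :
    M.Thm19d_inj := by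
  intro Z hZ ι _ _ _ S i
  obtain ⟨ρ, hρ, hn⟩ := hnat Z hZ ι S
  exact M.kummerToContainer_injective_of_naturality S hZ h16 h154 ρ hρ hn i

end IntrinsicKummerModel

end Literature.AnabelianGeometry.AbsoluteAnabelian.AbsTopIII
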